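import Mathlib
import HarnessLib
import Summits.Ventures.LatticeQCDFlow.Exactness.NCMCGeneralSpaceRestartChainEveryStart
import Summits.Ventures.LatticeQCDFlow.Exactness.NCMCGeneralSpaceMarkovErgodicPairs

/-!
# The BAR lane from EVERY pair of initial configurations: two independent restart chains, the Bennett root converges whatever the first records

HONEST FRAMING: exact (Metropolis-corrected) sampling algorithms for lattice gauge theory;
figures of merit are autocorrelation/cost numbers at stated couplings and volumes; no
continuum-physics claim.

Venture `LatticeQCDFlow` (cell pub-lqcd), topic `Exactness`; FANOUT row 13 (`eng-snf`, GEN-18).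
NEW WORK of the cell, not a published result; no definition is introduced; nothing is cited as a
fact.  GEN-16's `NCMCGeneralSpaceMarkovErgodicPairs.lean`: the two INDEPENDENT restart chains of
forward and reverse records (kernel `R₀ ∥ₖ R₁`, Mathlib `Kernel.parallelComp`), each with a minorised
invariant level sampler, form an ergodic pair chain from `P_F ⊗ P_R`, and every root sequence of the
sample Bennett equation converges to `ΔF` a.s. — from the EQUILIBRIUM start.  The pair kernel is
minorised in ONE step by `(κF ∘ₘ m₀) ⊗ (κR ∘ₘ m₁)` (GEN-16's `measure_le_parallelComp`), so GEN-18's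
Liouville step gives EVERY start; the root event is not a single Cesàro event, but GEN-16's
DETERMINISTIC bracketing (`eventually_rootSum_sign_of_tendsto`, `tendsto_root_of_eventually_sign`
in `NCMCGeneralSpaceErgodicRun`) derives it from countably many Cesàro events, each sure from every
start.

## Content

* §1 **`tendsto_root_anyLaw_of_nHit_minorised`** — general: `κ` Markov with a Doeblin power, `π`
  invariant, `ψ_d` a strictly increasing measurable `π`-integrable family with population root
  `∫ ψ_{d⋆} dπ = 0`: from EVERY initial law, almost surely EVERY sequence `d_n` solving
  `Σ_{i<n} ψ_{d_n}(x_i) = 0` for all large `n` converges to `d⋆`.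
* §2 `smul_normalised_prod_le_nHit_one` (the one-step minorisation of `R₀ ∥ₖ R₁` in skeleton form);
  **`CrooksPair.tendsto_barRoot_restartChains_anyLaw`** — Crooks pair (`e^{−ΔF} = Z₁/Z₀`), `ν₀`- /
  `ν₁`-invariant level samplers `K₀`, `K₁` dominating non-zero finite `m₀`, `m₁`: from EVERY initial
  law of the first record pair, a.s. every root sequence of the sample Bennett equation converges to
  `ΔF`; **`CrooksPair.tendsto_barRoot_restartChains_everyStart`** — the engine's form: first forward
  record launched from ANY `x`, first reverse record from ANY `y`.

NOT CLAIMED: rates (GEN-15's CLTs are for independent evolutions); anything numerical.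
-/

namespace Summit.Ventures.LatticeQCDFlow.Exactness.GeneralNCMC

open MeasureTheory ProbabilityTheory Set Filter Finset
open scoped ENNReal Topology

/-! ## §1 Monotone sample roots from every start under a Doeblin power -/

section Root

variable {X : Type*} [MeasurableSpace X] {κ : Kernel X X} [IsMarkovKernel κ] {π : Measure X}
  [IsProbabilityMeasure π] {m : ℕ} {ε : ℝ≥0∞} {ν : Measure X} [IsProbabilityMeasure ν]
  {ψ : ℝ → X → ℝ}

/-- **MONOTONE SAMPLE ROOTS CONVERGE FROM EVERY INITIAL LAW under a Doeblin power.**  `π` invariant,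
`ε • ν ≤ κ^m(z, ·)` for all `z` (`ε ≠ 0`); `ψ_d` measurable, `π`-integrable, strictly increasing in
`d`, with `∫ ψ_{d⋆} dπ = 0`: for every initial law `μ₀`, almost surely along the chain EVERY sequence
`d_n` with `Σ_{i<n} ψ_{d_n}(x_i) = 0` for all large `n` tends to `d⋆`. -/
theorem tendsto_root_anyLaw_of_nHit_minorised (hπ : Kernel.Invariant κ π) (hε : ε ≠ 0)
    (hmin : ∀ z, ε • ν ≤ nHit κ m z) (hmeas : ∀ d, Measurable (ψ d))
    (hstrict : ∀ x, StrictMono fun d => ψ d x) (hint : ∀ d, Integrable (ψ d) π) {dstar : ℝ}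
    (hroot : ∫ x, ψ dstar x ∂π = 0) (μ₀ : Measure X) [IsProbabilityMeasure μ₀] :
    ∀ᵐ ω ∂(Kernel.trajMeasure (X := fun _ : ℕ => X) μ₀
        (fun n : ℕ => κ.comap (fun h : (j : ↥(Finset.Iic n)) → X => h ⟨n, Finset.mem_Iic.2 le_rfl⟩)
          (measurable_pi_apply _))),
      ∀ dseq : ℕ → ℝ, (∀ᶠ n : ℕ in atTop, ∑ i ∈ range n, ψ (dseq n) (ω i) = 0) →
        Tendsto dseq atTop (𝓝 dstar) := by
  have hG := strictMono_integral_family π hstrict hint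
  have hup : ∀ᵐ ω ∂(Kernel.trajMeasure (X := fun _ : ℕ => X) μ₀
      (fun n : ℕ => κ.comap (fun h : (j : ↥(Finset.Iic n)) → X => h ⟨n, Finset.mem_Iic.2 le_rfl⟩)
        (measurable_pi_apply _))), ∀ k : ℕ,
      Tendsto (fun n : ℕ => (∑ i ∈ range n, ψ (dstar + 1 / (k + 1)) (ω i)) / n) atTop
        (𝓝 (∫ x, ψ (dstar + 1 / (k + 1)) x ∂π)) :=
    ae_all_iff.2 fun k => tendsto_sum_div_anyLaw_of_nHit_minorised hπ hε hmin (hmeas _) (hint _) μ₀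
  have hdn : ∀ᵐ ω ∂(Kernel.trajMeasure (X := fun _ : ℕ => X) μ₀
      (fun n : ℕ => κ.comap (fun h : (j : ↥(Finset.Iic n)) → X => h ⟨n, Finset.mem_Iic.2 le_rfl⟩)
        (measurable_pi_apply _))), ∀ k : ℕ,
      Tendsto (fun n : ℕ => (∑ i ∈ range n, ψ (dstar - 1 / (k + 1)) (ω i)) / n) atTop
        (𝓝 (∫ x, ψ (dstar - 1 / (k + 1)) x ∂π)) :=
    ae_all_iff.2 fun k => tendsto_sum_div_anyLaw_of_nHit_minorised hπ hε hmin (hmeas _) (hint _) μ₀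
  filter_upwards [hup, hdn] with ω hωup hωdn dseq hdseq
  exact tendsto_root_of_eventually_sign
    (eventually_rootSum_sign_of_tendsto hstrict hG (dstar := dstar) hroot hωup hωdn) hdseq

end Root

/-! ## §2 Two independent restart chains: the Bennett root from every pair of starts -/

section Pair

variable {S₁ S₂ : Type*} [MeasurableSpace S₁] [MeasurableSpace S₂]

/-- **The pair kernel is minorised in one step** (skeleton form): `mᵢ ≤ κᵢ(z, ·)` for all `z`
(`m₁ ⊗ m₂` finite non-zero) gives
`(m₁ ⊗ m₂)(univ) • (((m₁ ⊗ m₂)(univ))⁻¹ (m₁ ⊗ m₂)) ≤ nHit (κ₁ ∥ₖ κ₂) 1 p` for every `p`. -/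
theorem smul_normalised_prod_le_nHit_one (κ₁ : Kernel S₁ S₁) (κ₂ : Kernel S₂ S₂)
    [IsMarkovKernel κ₁] [IsMarkovKernel κ₂] {m₁ : Measure S₁} {m₂ : Measure S₂}
    [IsFiniteMeasure m₁] [IsFiniteMeasure m₂] (hm : (m₁.prod m₂) univ ≠ 0)
    (hmin₁ : ∀ z, m₁ ≤ κ₁ z) (hmin₂ : ∀ z, m₂ ≤ κ₂ z) (p : S₁ × S₂) :
    (m₁.prod m₂) univ • (((m₁.prod m₂) univ)⁻¹ • m₁.prod m₂) ≤ nHit (κ₁ ∥ₖ κ₂) 1 p := by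
  rw [nHit_one, smul_smul, ENNReal.mul_inv_cancel hm (measure_ne_top _ _), one_smul]
  exact measure_le_parallelComp κ₁ κ₂ hmin₁ hmin₂ p

end Pair

namespace CrooksPair

variable {Ω E : Type*} [MeasurableSpace Ω] [MeasurableSpace E]
variable {ν₀ ν₁ : Measure Ω} [IsFiniteMeasure ν₀] [IsFiniteMeasure ν₁] {κF κR : Kernel Ω E}
  [IsMarkovKernel κF] [IsMarkovKernel κR] {s e : E → Ω} {W : E → ℝ}

/-- **THE BAR ROOT CONVERGES FROM EVERY INITIAL LAW OF THE FIRST RECORD PAIR.**  Crooks pair with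
`e^{−ΔF} = Z₁/Z₀`; `ν₀`-invariant `K₀` and `ν₁`-invariant `K₁` dominating non-zero finite `m₀`, `m₁`
from every configuration; the two restart chains of forward and reverse records run INDEPENDENTLY
and are paired index by index.  For every initial law `μ₀` on `E × E`: almost surely, EVERY sequence
`d_n` solving the sample Bennett equation `Σ_{i<n} σ(d_n − W_i) = Σ_{i<n} σ(W'_i − d_n)` for all
large `n` converges to `ΔF`. -/
theorem tendsto_barRoot_restartChains_anyLaw (K₀ K₁ : Kernel Ω Ω) [IsMarkovKernel K₀]
    [IsMarkovKernel K₁] (h0 : ν₀ univ ≠ 0) (h1 : ν₁ univ ≠ 0) (hK₀ : Kernel.Invariant K₀ ν₀)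
    (hK₁ : Kernel.Invariant K₁ ν₁) (h : CrooksPair ν₀ ν₁ κF κR s e W) {ΔF : ℝ}
    (hΔF : Real.exp (-ΔF) = ((ν₀ univ)⁻¹ * ν₁ univ).toReal)
    {m₀ m₁ : Measure Ω} [IsFiniteMeasure m₀] [IsFiniteMeasure m₁] (hm₀ : m₀ univ ≠ 0)
    (hm₁ : m₁ univ ≠ 0) (hmin₀ : ∀ z, m₀ ≤ K₀ z) (hmin₁ : ∀ z, m₁ ≤ K₁ z)
    (μ₀ : Measure (E × E)) [IsProbabilityMeasure μ₀] :
    ∀ᵐ x ∂(Kernel.trajMeasure (X := fun _ : ℕ => E × E) μ₀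
        (fun n : ℕ => (((κF ∘ₖ K₀).comap s h.measurable_s) ∥ₖ ((κR ∘ₖ K₁).comap e h.measurable_e)).comap
          (fun hh : (j : ↥(Finset.Iic n)) → E × E => hh ⟨n, Finset.mem_Iic.2 le_rfl⟩)
          (measurable_pi_apply _))),
      ∀ dseq : ℕ → ℝ,
        (∀ᶠ n : ℕ in atTop, (∑ i ∈ range n, Real.sigmoid (dseq n - W (x i).1)) -
          ∑ i ∈ range n, Real.sigmoid (W (x i).2 - dseq n) = 0) →
        Tendsto dseq atTop (𝓝 ΔF) := by
  haveI := isProbabilityMeasure_fwdPathLaw ν₀ h0 κF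
  haveI := isProbabilityMeasure_fwdPathLaw ν₁ h1 κR
  have hI₀ := h.invariant_restartKernel K₀ hK₀
  have hI₁ := h.invariant_restartKernel_rev K₁ hK₁
  have hinv := invariant_parallelComp _ _ hI₀ hI₁
  haveI : IsFiniteMeasure (m₀.bind κF) := inferInstance
  haveI : IsFiniteMeasure (m₁.bind κR) := inferInstance
  have hprod : ((m₀.bind κF).prod (m₁.bind κR)) univ ≠ 0 :=
    prod_apply_univ_ne_zero (by rw [bind_apply_univ_of_markov]; exact hm₀)
      (by rw [bind_apply_univ_of_markov]; exact hm₁)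
  haveI : IsProbabilityMeasure ((((m₀.bind κF).prod (m₁.bind κR)) univ)⁻¹ •
      (m₀.bind κF).prod (m₁.bind κR)) :=
    ⟨by rw [Measure.smul_apply, smul_eq_mul, ENNReal.inv_mul_cancel hprod (measure_ne_top _ _)]⟩
  have hD := smul_normalised_prod_le_nHit_one ((κF ∘ₖ K₀).comap s h.measurable_s)
    ((κR ∘ₖ K₁).comap e h.measurable_e) hprod (measure_le_comp_comap K₀ κF h.measurable_s hmin₀)
    (measure_le_comp_comap K₁ κR h.measurable_e hmin₁)
  -- the estimating family `ψ_d(p) = σ(d − W p.1) − σ(W p.2 − d)`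
  have hmeas : ∀ d, Measurable fun p : E × E => Real.sigmoid (d - W p.1) - Real.sigmoid (W p.2 - d) :=
    fun d => (_root_.continuous_sigmoid.measurable.comp
      (measurable_const.sub (h.measurable_W.comp measurable_fst))).sub
      (_root_.continuous_sigmoid.measurable.comp ((h.measurable_W.comp measurable_snd).sub
        measurable_const))
  have hint : ∀ d, Integrable (fun p : E × E => Real.sigmoid (d - W p.1) - Real.sigmoid (W p.2 - d))
      ((fwdPathLaw ν₀ κF).prod (fwdPathLaw ν₁ κR)) := fun d =>
    (integrable_sigmoid_comp (measurable_const.sub (h.measurable_W.comp measurable_fst))).sub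
      (integrable_sigmoid_comp ((h.measurable_W.comp measurable_snd).sub measurable_const))
  -- the population root is `ΔF` (through the stationary pair chain's time-zero marginal)
  have hroot : ∫ p, (Real.sigmoid (ΔF - W p.1) - Real.sigmoid (W p.2 - ΔF))
      ∂((fwdPathLaw ν₀ κF).prod (fwdPathLaw ν₁ κR)) = 0 := by
    have hmarg := chain_map_eval_of_invariant _ hinv 0
    rw [← hmarg, integral_barSummand_eq h.measurable_W (map_fst_eval_chain_prod _ _ hI₀ hI₁)
      (map_snd_eval_chain_prod _ _ hI₀ hI₁), (h.integral_sigmoid_fwd_eq_rev_iff h0 h1 hΔF ΔF).2 rfl,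
      sub_self]
  have key := tendsto_root_anyLaw_of_nHit_minorised hinv hprod hD
    (ψ := fun d (p : E × E) => Real.sigmoid (d - W p.1) - Real.sigmoid (W p.2 - d))
    hmeas (barSummand_strictMono W) hint hroot μ₀
  filter_upwards [key] with x hx dseq hdseq
  refine hx dseq ?_
  filter_upwards [hdseq] with n hn
  rw [← hn, sum_sub_distrib]

/-- **THE BAR LANE FROM EVERY PAIR OF INITIAL CONFIGURATIONS** — the engine's form: first forward
record launched from ANY `x`, first reverse record launched from ANY `y`, then `K₀` / `K₁` between
launches on each leg independently: almost surely every root sequence of the sample Bennett equation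
converges to `ΔF`. -/
theorem tendsto_barRoot_restartChains_everyStart (K₀ K₁ : Kernel Ω Ω) [IsMarkovKernel K₀]
    [IsMarkovKernel K₁] (h0 : ν₀ univ ≠ 0) (h1 : ν₁ univ ≠ 0) (hK₀ : Kernel.Invariant K₀ ν₀)
    (hK₁ : Kernel.Invariant K₁ ν₁) (h : CrooksPair ν₀ ν₁ κF κR s e W) {ΔF : ℝ}
    (hΔF : Real.exp (-ΔF) = ((ν₀ univ)⁻¹ * ν₁ univ).toReal)
    {m₀ m₁ : Measure Ω} [IsFiniteMeasure m₀] [IsFiniteMeasure m₁] (hm₀ : m₀ univ ≠ 0)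
    (hm₁ : m₁ univ ≠ 0) (hmin₀ : ∀ z, m₀ ≤ K₀ z) (hmin₁ : ∀ z, m₁ ≤ K₁ z) (x y : Ω) :
    ∀ᵐ ω ∂(Kernel.trajMeasure (X := fun _ : ℕ => E × E) ((κF x).prod (κR y))
        (fun n : ℕ => (((κF ∘ₖ K₀).comap s h.measurable_s) ∥ₖ ((κR ∘ₖ K₁).comap e h.measurable_e)).comap
          (fun hh : (j : ↥(Finset.Iic n)) → E × E => hh ⟨n, Finset.mem_Iic.2 le_rfl⟩)
          (measurable_pi_apply _))),
      ∀ dseq : ℕ → ℝ,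
        (∀ᶠ n : ℕ in atTop, (∑ i ∈ range n, Real.sigmoid (dseq n - W (ω i).1)) -
          ∑ i ∈ range n, Real.sigmoid (W (ω i).2 - dseq n) = 0) →
        Tendsto dseq atTop (𝓝 ΔF) :=
  h.tendsto_barRoot_restartChains_anyLaw K₀ K₁ h0 h1 hK₀ hK₁ hΔF hm₀ hm₁ hmin₀ hmin₁
    ((κF x).prod (κR y))

end CrooksPair

end Summit.Ventures.LatticeQCDFlow.Exactness.GeneralNCMC
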